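import Mathlib
import HarnessLib
import Summits.HubbardSuperconductivity.HubbardSuperconductivity.Theorems.KLProgrammeKLRegimeEngineFrameShiftResponseFourLegDressing

/-!
# Route `KLProgramme` — ENGINE item stmt-HubbardSuperconductivity-20437 `KLRegimeEngineV17F2`, stub (c) `hshift` producer: the loop share with an ABSTRACT
# ℓ¹ RESPONSE RATE `σ₁` of the mismatch defect, and the SUPPORT-RESOLVED rate (located risk #6b «(c)-HSHIFT-N6-COUNT», cure on the symbol side;
# cell gate-hubbard-kl, seat p2 g24)

WHY.  The loop share of the four-leg frame response reads `30·(Σ_p ‖ṡ(p)‖)·N₆` (`ṡ = Ψ̃ − Ψ_{K₁}`, `N₆` a FLAT sup of the six-leg kernel at `(X, Ā, A)`).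
p670081/p670471 priced `Σ_p ‖ṡ(p)‖` by `#{p : |ω_p| < Λ_n}·βL²(200+200B₁)/Λ_n²·fd` (k3c4-p2's `sum_norm_mismatchDefect_le`: every lattice momentum counted).  With
`N₆` of its natural size `≍ U²/Λ_n` (k3c3-p1 g15, tree level, upper AND lower) that loop share is `∝ U²·fd/Λ_n²` — one power of `Λ_n` short of the `4^{−n}`
budget `frameShiftBar`.  The power is recovered on the SYMBOL side: `ṡ(p) = 0` unless `p` lies in the scale-`n` transition shell — in particular unless
`|e_{K₁}(k⃗_p)| < 5Λ_n/4` (both frames are above the shell when `|e_{K₁}| ≥ 5Λ/4` and `|D| ≤ Λ/4`) — so the count is `#{(ω,k⃗,σ) : |ω| < Λ_n, |e_{K₁}(k⃗)| < 5Λ_n/4}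
= 2·#{|ω|<Λ_n}·#{k⃗ : |e_{K₁}(k⃗)| < 5Λ_n/4}`, whose momentum factor is a BAND-SHELL COUNT `≲ C·L²·Λ_n` (Fermi-curve geometry) instead of `L²`.
* §1 `mismatchDefect_eq_zero_of_band_ge` (`|D(p_k⃗)| ≤ Λ/4`, `5Λ/4 ≤ |e_{K₁}(k⃗)|` ⇒ `ṡ = 0`), **`sum_norm_mismatchDefect_le_support`**
  (`Σ_p ‖ṡ(p)‖ ≤ #{|ω|<Λ ∧ |e_{K₁}|<5Λ/4}·βL²(200+200B₁)/Λ²·t`), `card_freqBand_eq` (`= 2·#freq·#band`), `card_freqBand_le` (`≤ 2(Λβ/π + 3)·#band`).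
* §2 the chain with an ABSTRACT ℓ¹ rate `Σ_p ‖ṡ(p)‖ ≤ σ₁·frameDist K₂ K₁`: **`covRespCT_norm_kernel_four_mismatch_sub_le_rate`**,
  **`norm_kernel_four_klEffectiveAction_frame_sub_le_rate`**, **`norm_klPairAmplitude_frame_sub_le_priced₁_rate`**:
  `‖𝒞_n[K₂] − 𝒞_n[K₁]‖ ≤ ((6075/2)·A₄/Λ_n + 24(|β|L²)³·(30·σ₁·N₆ + 8·βL²(200+200B₁)/Λ_n²·S·N₄))·frameDist K₂ K₁` — any sharper ℓ¹ rate (support-,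
  sector- or weight-resolved) plugs in as `σ₁` without new twins; the support-resolved instance is `σ₁ := #{|ω|<Λ_n ∧ |e_{K₁}|<5Λ_n/4}·βL²(200+200B₁)/Λ_n²`.
SIZE (pencil, vertexFn units, for the (c) closer): with `#band ≤ C·L²·Λ_n` the loop share is `≈ (800/π)·B₁·C·N₆^V·fd` (β, L AND Λ_n cancel), so `N₆^V ≲ c₆(KlamU)²/Λ_n`
gives `ℓ₂ ≈ 255·B₁·C·c₆·(KlamU)²/Λ_n ≤ klHshiftC·(KlamU)²/Λ_n` with room (`B₁ = 2736`).  Proofs only; no definitions; `σ₁, N₆, S, N₄, A₄` and the band count are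
hypotheses/terms, nothing about their sizes is asserted; nothing here asserts (c), any stub of 20437, K3, the margin or superconductivity.
References: BGM 2006 §2.2–2.3 (2.21)–(2.28), (2.36) [cite: BenfattoGiulianiMastropietro2006]; FST 1996 §1 [cite: FeldmanSalmhoferTrubowitz1996].
-/

noncomputable section

namespace Summit.HubbardSuperconductivity.HubbardSuperconductivity.Theorems.EngineV8

set_option linter.dupNamespace false -- summit = problem name (single-conjunct summit), D-0017

open Finset Literature.MathematicalPhysics.QuantumLattice Literature.Probability.LatticeModels GrassmannAlgebra
open Summit.HubbardSuperconductivity.HubbardSuperconductivity.Theorems.TwoPointAssembly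
open Summit.HubbardSuperconductivity.HubbardSuperconductivity.Theorems.TwoVolumeDefect
open Summit.HubbardSuperconductivity.HubbardSuperconductivity.Theorems.KLRegimeSplit
open Summit.HubbardSuperconductivity.HubbardSuperconductivity.Theorems.KLProgrammeLegKernels

/-! ## §1 The defect is supported on the band shell `|e_{K₁}(k⃗)| < 5Λ/4`; support-resolved ℓ¹ size; the count factorises -/

section Support

variable {L M : ℕ} [NeZero L] {β : ℝ} (hβ : 0 < β) (μ : ℝ) (K₁ K₂ : TrigPolyC4v) {Λ : ℝ} (hΛ : 0 < Λ)
include hβ hΛ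

/-- **The defect vanishes off the band shell**: if `|D(p_k⃗)| ≤ Λ/4` and `5Λ/4 ≤ |e_{K₁}(k⃗)|` then both frames are above the shell at every frequency
(`e_{K₁}² ≥ Λ²`, `|e_{K₂}| = |e_{K₁} − D| ≥ Λ`), so `Ψ̃ − Ψ_{K₁} = 0` there. [cite: BenfattoGiulianiMastropietro2006, §2.2 (2.27)–(2.28)] -/
theorem mismatchDefect_eq_zero_of_band_ge (i : MatsubaraIdx M) (kv : TorusSite 2 L) (σ : Fin 2)
    (hD : |(fsub K₂ K₁).eval (latticeMomentum L kv)| ≤ Λ / 4) (he : 5 * Λ / 4 ≤ |nambuXiCT L μ K₁ kv|) :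
    uvSymbolCT L M β μ K₂ Λ ((i, kv), σ) /
          (1 + uvSymbolCT L M β μ K₂ Λ ((i, kv), σ) * (((fsub K₂ K₁).eval (latticeMomentum L kv) / (β * (L : ℝ) ^ 2) : ℝ) : ℂ)) -
        uvSymbolCT L M β μ K₁ Λ ((i, kv), σ) = 0 := by
  have hω2 : 0 ≤ matsubaraFreq β M i ^ 2 := sq_nonneg _
  have h1 : Λ ^ 2 ≤ nambuXiCT L μ K₁ kv ^ 2 := by
    have : Λ ≤ |nambuXiCT L μ K₁ kv| := by linarith
    calc Λ ^ 2 ≤ |nambuXiCT L μ K₁ kv| ^ 2 := by gcongr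
      _ = _ := sq_abs _
  have h2 : Λ ^ 2 ≤ nambuXiCT L μ K₂ kv ^ 2 := by
    rw [nambuXiCT_eq_sub_eval_fsub (L := L) μ K₁ K₂ kv]
    have h3 : Λ ≤ |nambuXiCT L μ K₁ kv - (fsub K₂ K₁).eval (latticeMomentum L kv)| := by
      have := abs_sub_abs_le_abs_sub (nambuXiCT L μ K₁ kv) ((fsub K₂ K₁).eval (latticeMomentum L kv))
      linarith
    calc Λ ^ 2 ≤ |nambuXiCT L μ K₁ kv - (fsub K₂ K₁).eval (latticeMomentum L kv)| ^ 2 := by gcongr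
      _ = _ := sq_abs _
  exact mismatchDefect_eq_zero_of_ge hβ μ K₁ K₂ Λ hΛ i kv σ (le_add_of_nonneg_of_le hω2 h2) (le_add_of_nonneg_of_le hω2 h1)

/-- **SUPPORT-RESOLVED ℓ¹ size of the defect**: if `|D(p_k⃗)| ≤ t ≤ Λ/4` at every lattice momentum then
`Σ_{ks} ‖Ψ̃(ks) − Ψ_{K₁}(ks)‖ ≤ #{ks : |ω| < Λ ∧ |e_{K₁}(k⃗)| < 5Λ/4} · βL²(200+200B₁)/Λ² · t` (the terms vanish off the frequency window AND off the band shell).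
[cite: BenfattoGiulianiMastropietro2006, §2.2 (2.27)–(2.28)] -/
theorem sum_norm_mismatchDefect_le_support {B₁ : ℝ} (hB0 : 0 ≤ B₁) (hB : ∀ y, |deriv salmhoferCutoff y| ≤ B₁)
    {t : ℝ} (ht : t ≤ Λ / 4) (hD : ∀ kv : TorusSite 2 L, |(fsub K₂ K₁).eval (latticeMomentum L kv)| ≤ t) :
    ∑ ks : FreqMomentum L M × Fin 2,
        ‖uvSymbolCT L M β μ K₂ Λ ks /
              (1 + uvSymbolCT L M β μ K₂ Λ ks * (((fsub K₂ K₁).eval (latticeMomentum L ks.1.2) / (β * (L : ℝ) ^ 2) : ℝ) : ℂ)) -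
            uvSymbolCT L M β μ K₁ Λ ks‖ ≤
      ((Finset.univ.filter fun ks : FreqMomentum L M × Fin 2 =>
          |matsubaraFreq β M ks.1.1| < Λ ∧ |nambuXiCT L μ K₁ ks.1.2| < 5 * Λ / 4).card : ℝ) *
        (β * (L : ℝ) ^ 2 * (200 + 200 * B₁) / Λ ^ 2 * t) := by
  classical
  have hL : (0 : ℝ) < L := by exact_mod_cast NeZero.pos L
  have ht0 : 0 ≤ t := (abs_nonneg _).trans (hD 0)
  have hC : 0 ≤ β * (L : ℝ) ^ 2 * (200 + 200 * B₁) / Λ ^ 2 * t := by positivity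
  calc ∑ ks : FreqMomentum L M × Fin 2,
        ‖uvSymbolCT L M β μ K₂ Λ ks /
              (1 + uvSymbolCT L M β μ K₂ Λ ks * (((fsub K₂ K₁).eval (latticeMomentum L ks.1.2) / (β * (L : ℝ) ^ 2) : ℝ) : ℂ)) -
            uvSymbolCT L M β μ K₁ Λ ks‖
      ≤ ∑ ks : FreqMomentum L M × Fin 2,
          (if |matsubaraFreq β M ks.1.1| < Λ ∧ |nambuXiCT L μ K₁ ks.1.2| < 5 * Λ / 4 then
            β * (L : ℝ) ^ 2 * (200 + 200 * B₁) / Λ ^ 2 * t else 0) := by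
        refine Finset.sum_le_sum fun ks _ => ?_
        obtain ⟨⟨i, kv⟩, σ⟩ := ks
        dsimp only
        split_ifs with h
        · refine (norm_mismatchDefect_le hβ μ K₁ K₂ Λ hB0 hB hΛ i kv σ ((hD kv).trans ht)).trans ?_
          exact mul_le_mul_of_nonneg_left (hD kv) (by positivity)
        · rw [not_and_or, not_lt, not_lt] at h
          rcases h with h | h
          · rw [mismatchDefect_eq_zero_of_freq_ge hβ μ K₁ K₂ Λ hΛ i kv σ h, norm_zero]
          · rw [mismatchDefect_eq_zero_of_band_ge hβ μ K₁ K₂ hΛ i kv σ ((hD kv).trans ht) h, norm_zero]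
    _ = _ := by
        rw [Finset.sum_ite, Finset.sum_const_zero, add_zero, Finset.sum_const, nsmul_eq_mul]

omit hβ hΛ in
/-- **The support count factorises**: `#{(ω,k⃗,σ) : |ω| < Λ ∧ |e_{K₁}(k⃗)| < 5Λ/4} = 2 · #{i : |ω_i| < Λ} · #{k⃗ : |e_{K₁}(k⃗)| < 5Λ/4}`. -/
theorem card_freqBand_eq :
    (Finset.univ.filter fun ks : FreqMomentum L M × Fin 2 =>
        |matsubaraFreq β M ks.1.1| < Λ ∧ |nambuXiCT L μ K₁ ks.1.2| < 5 * Λ / 4).card =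
      2 * ((Finset.univ.filter fun i : MatsubaraIdx M => |matsubaraFreq β M i| < Λ).card *
        (Finset.univ.filter fun kv : TorusSite 2 L => |nambuXiCT L μ K₁ kv| < 5 * Λ / 4).card) := by
  classical
  have hset : (Finset.univ.filter fun ks : FreqMomentum L M × Fin 2 =>
        |matsubaraFreq β M ks.1.1| < Λ ∧ |nambuXiCT L μ K₁ ks.1.2| < 5 * Λ / 4) =
      (((Finset.univ.filter fun i : MatsubaraIdx M => |matsubaraFreq β M i| < Λ) ×ˢ
        (Finset.univ.filter fun kv : TorusSite 2 L => |nambuXiCT L μ K₁ kv| < 5 * Λ / 4)) ×ˢ (Finset.univ : Finset (Fin 2))) := by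
    ext ⟨⟨i, kv⟩, σ⟩
    simp [Finset.mem_product]
  rw [hset, Finset.card_product, Finset.card_product, Finset.card_univ, Fintype.card_fin]
  ring

omit hΛ in
/-- **The support count against the band-shell count**: `#{(ω,k⃗,σ) : |ω| < Λ ∧ |e_{K₁}| < 5Λ/4} ≤ 2·(Λβ/π + 3)·#{k⃗ : |e_{K₁}(k⃗)| < 5Λ/4}` (`0 ≤ Λ`).
[cite: BenfattoGiulianiMastropietro2006, §2.3] -/
theorem card_freqBand_le (hΛ0 : 0 ≤ Λ) :
    ((Finset.univ.filter fun ks : FreqMomentum L M × Fin 2 =>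
        |matsubaraFreq β M ks.1.1| < Λ ∧ |nambuXiCT L μ K₁ ks.1.2| < 5 * Λ / 4).card : ℝ) ≤
      2 * (Λ * β / Real.pi + 3) * ((Finset.univ.filter fun kv : TorusSite 2 L => |nambuXiCT L μ K₁ kv| < 5 * Λ / 4).card : ℝ) := by
  rw [card_freqBand_eq (L := L) (M := M) (β := β) μ K₁ (Λ := Λ)]
  push_cast
  have hfreq := card_filter_matsubaraFreq_le hβ hΛ0 (Finset.univ.filter fun i : MatsubaraIdx M => |matsubaraFreq β M i| < Λ)
    (fun i hi => ((Finset.mem_filter.mp hi).2).le)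
  have hb : 0 ≤ ((Finset.univ.filter fun kv : TorusSite 2 L => |nambuXiCT L μ K₁ kv| < 5 * Λ / 4).card : ℝ) := by positivity
  nlinarith

end Support

/-! ## §2 The chain with an ABSTRACT ℓ¹ response rate `Σ_p ‖ṡ(p)‖ ≤ σ₁·frameDist K₂ K₁` -/

variable {L M : ℕ} [NeZero L] [NeZero M]

omit [NeZero M] in
/-- **THE FOUR-LEG MISMATCH RESPONSE AT ONE STRING, ℓ¹-RATE FORM**: as `covRespCT_norm_kernel_four_mismatch_sub_le` (p670081) but with the flat frequency-window
count replaced by an abstract rate `Σ_p ‖Ψ̃(p) − Ψ_{K₁}(p)‖ ≤ σ₁·frameDist K₂ K₁`: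
`‖𝒲′[Ψ̃]₄(X) − 𝒲′[Ψ_{K₁}]₄(X)‖ ≤ 30·(σ₁·fd)·N₆ + 8·(βL²(200+200B₁)/Λ²·fd)·S·N₄`. [cite: BenfattoGiulianiMastropietro2006, §2.3 (2.21)–(2.24)] -/
theorem covRespCT_norm_kernel_four_mismatch_sub_le_rate {β : ℝ} (hβ : 0 < β) {B₁ : ℝ} (hB0 : 0 ≤ B₁) (hB : ∀ y, |deriv salmhoferCutoff y| ≤ B₁)
    {Λ : ℝ} (hΛ : 0 < Λ) (μ U : ℝ) (K₁ K₂ : TrigPolyC4v) (hfd : frameDist K₂ K₁ ≤ Λ / 4) {s₀ s₁ : FreqMomentum L M × Fin 2 → ℂ}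
    (hs₀ : s₀ = uvSymbolCT L M β μ K₁ Λ)
    (hs₁ : s₁ = fun ks => uvSymbolCT L M β μ K₂ Λ ks /
      (1 + uvSymbolCT L M β μ K₂ Λ ks * (((fsub K₂ K₁).eval (latticeMomentum L ks.1.2) / (β * (L : ℝ) ^ 2) : ℝ) : ℂ)))
    {σ₁ : ℝ} (hσ : ∑ p, ‖s₁ p - s₀ p‖ ≤ σ₁ * frameDist K₂ K₁)
    (X : Fin 4 → HubbardFieldIdx L M)
    (hZ : ∀ t ∈ Set.Icc (0 : ℝ) 1, effPartitionFn ℂ (normalCovariance L M s₀ + ((t : ℂ)) • (normalCovariance L M s₁ - normalCovariance L M s₀))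
      (hubbardInteraction L M β U + counterQuadratic L M β K₁) ≠ 0)
    {N₆ S N₄ : ℝ}
    (hN6 : ∀ t ∈ Set.Icc (0 : ℝ) 1, ∀ A : HubbardFieldIdx L M,
      ‖kernel ℂ (effAction ℂ (normalCovariance L M s₀ + ((t : ℂ)) • (normalCovariance L M s₁ - normalCovariance L M s₀))
        (hubbardInteraction L M β U + counterQuadratic L M β K₁)) 6 (Fin.snoc (Fin.snoc X (A.1, 1 - A.2) : Fin 5 → HubbardFieldIdx L M) A)‖ ≤ N₆)
    (hS : ∀ t ∈ Set.Icc (0 : ℝ) 1, ∀ i : Fin 4,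
      ‖kernel ℂ (effAction ℂ (normalCovariance L M s₀ + ((t : ℂ)) • (normalCovariance L M s₁ - normalCovariance L M s₀))
        (hubbardInteraction L M β U + counterQuadratic L M β K₁)) 2 ![(((X i).1, 1 - (X i).2) : HubbardFieldIdx L M), X i]‖ ≤ S)
    (hN4 : ∀ t ∈ Set.Icc (0 : ℝ) 1,
      ‖kernel ℂ (effAction ℂ (normalCovariance L M s₀ + ((t : ℂ)) • (normalCovariance L M s₁ - normalCovariance L M s₀))
        (hubbardInteraction L M β U + counterQuadratic L M β K₁)) 4 X‖ ≤ N₄) :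
    ‖kernel ℂ (effAction ℂ (normalCovariance L M s₁) (hubbardInteraction L M β U + counterQuadratic L M β K₁)) 4 X -
        kernel ℂ (effAction ℂ (normalCovariance L M s₀) (hubbardInteraction L M β U + counterQuadratic L M β K₁)) 4 X‖ ≤
      30 * (σ₁ * frameDist K₂ K₁) * N₆ + 8 * (β * (L : ℝ) ^ 2 * (200 + 200 * B₁) / Λ ^ 2 * frameDist K₂ K₁) * S * N₄ := by
  have hL : (0 : ℝ) < L := by exact_mod_cast NeZero.pos L
  have hD : ∀ kv : TorusSite 2 L, |(fsub K₂ K₁).eval (latticeMomentum L kv)| ≤ frameDist K₂ K₁ := fun kv => by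
    rw [eval_fsub]; exact abs_eval_sub_le_frameDist K₂ K₁ _
  have hDi : ∀ i : Fin 4, ‖s₁ (X i).1 - s₀ (X i).1‖ ≤ β * (L : ℝ) ^ 2 * (200 + 200 * B₁) / Λ ^ 2 * frameDist K₂ K₁ := by
    intro i
    subst hs₀ hs₁
    have h := norm_mismatchDefect_le hβ μ K₁ K₂ Λ hB0 hB hΛ (X i).1.1.1 (X i).1.1.2 (X i).1.2 ((hD _).trans hfd)
    exact h.trans (mul_le_mul_of_nonneg_left (hD _) (by positivity))
  have h := covRespCT_norm_kernel_four_sub_le s₀ s₁ β U K₁ X hZ hN6 hS hN4 hDi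
  refine h.trans (add_le_add ?_ le_rfl)
  have hN60 : 0 ≤ N₆ := (norm_nonneg _).trans (hN6 0 ⟨le_rfl, zero_le_one⟩ (X 0))
  exact mul_le_mul_of_nonneg_right (mul_le_mul_of_nonneg_left hσ (by norm_num)) hN60

/-- **THE FRAME-SHIFT RESPONSE OF THE SCALE-`n` FOUR-LEG KERNEL, ℓ¹-RATE FORM, DRESSING PRICED**:
`‖T_n(K₂)₄(X) − T_n(K₁)₄(X)‖ ≤ (600·fd/Λ_n)·N₄′ + 30·(σ₁·fd)·N₆ + 8·(βL²(200+200B₁)/Λ_n²·fd)·S·N₄`. [cite: BenfattoGiulianiMastropietro2006, §2.3 (2.21)–(2.24)] -/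
theorem norm_kernel_four_klEffectiveAction_frame_sub_le_rate {β : ℝ} (hβ : 0 < β) {B₁ : ℝ} (hB0 : 0 ≤ B₁) (hB : ∀ y, |deriv salmhoferCutoff y| ≤ B₁)
    (U μ : ℝ) (K₁ K₂ : TrigPolyC4v) (n : ℕ) (hfd : frameDist K₂ K₁ ≤ klScale klE0 n / 4)
    (hZ₂ : effPartitionFn ℂ (normalCovariance L M (uvSymbolCT L M β μ K₂ (klScale klE0 n)))
      (hubbardInteraction L M β U + counterQuadratic L M β K₂) ≠ 0)
    {s₀ s₁ : FreqMomentum L M × Fin 2 → ℂ} (hs₀ : s₀ = uvSymbolCT L M β μ K₁ (klScale klE0 n))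
    (hs₁ : s₁ = fun ks => uvSymbolCT L M β μ K₂ (klScale klE0 n) ks /
      (1 + uvSymbolCT L M β μ K₂ (klScale klE0 n) ks * (((fsub K₂ K₁).eval (latticeMomentum L ks.1.2) / (β * (L : ℝ) ^ 2) : ℝ) : ℂ)))
    {σ₁ : ℝ} (hσ : ∑ p, ‖s₁ p - s₀ p‖ ≤ σ₁ * frameDist K₂ K₁)
    (X : Fin 4 → HubbardFieldIdx L M) {N₄' N₆ S N₄ : ℝ}
    (hN4' : ‖kernel ℂ (effAction ℂ (normalCovariance L M s₁) (hubbardInteraction L M β U + counterQuadratic L M β K₁)) 4 X‖ ≤ N₄')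
    (hZ : ∀ t ∈ Set.Icc (0 : ℝ) 1, effPartitionFn ℂ (normalCovariance L M s₀ + ((t : ℂ)) • (normalCovariance L M s₁ - normalCovariance L M s₀))
      (hubbardInteraction L M β U + counterQuadratic L M β K₁) ≠ 0)
    (hN6 : ∀ t ∈ Set.Icc (0 : ℝ) 1, ∀ A : HubbardFieldIdx L M,
      ‖kernel ℂ (effAction ℂ (normalCovariance L M s₀ + ((t : ℂ)) • (normalCovariance L M s₁ - normalCovariance L M s₀))
        (hubbardInteraction L M β U + counterQuadratic L M β K₁)) 6 (Fin.snoc (Fin.snoc X (A.1, 1 - A.2) : Fin 5 → HubbardFieldIdx L M) A)‖ ≤ N₆)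
    (hS : ∀ t ∈ Set.Icc (0 : ℝ) 1, ∀ i : Fin 4,
      ‖kernel ℂ (effAction ℂ (normalCovariance L M s₀ + ((t : ℂ)) • (normalCovariance L M s₁ - normalCovariance L M s₀))
        (hubbardInteraction L M β U + counterQuadratic L M β K₁)) 2 ![(((X i).1, 1 - (X i).2) : HubbardFieldIdx L M), X i]‖ ≤ S)
    (hN4 : ∀ t ∈ Set.Icc (0 : ℝ) 1,
      ‖kernel ℂ (effAction ℂ (normalCovariance L M s₀ + ((t : ℂ)) • (normalCovariance L M s₁ - normalCovariance L M s₀))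
        (hubbardInteraction L M β U + counterQuadratic L M β K₁)) 4 X‖ ≤ N₄) :
    ‖kernel ℂ (klEffectiveAction L M β U μ K₂ klE0 n) 4 X - kernel ℂ (klEffectiveAction L M β U μ K₁ klE0 n) 4 X‖ ≤
      600 * frameDist K₂ K₁ / klScale klE0 n * N₄' +
        (30 * (σ₁ * frameDist K₂ K₁) * N₆ +
          8 * (β * (L : ℝ) ^ 2 * (200 + 200 * B₁) / klScale klE0 n ^ 2 * frameDist K₂ K₁) * S * N₄) := by
  have hΛ : 0 < klScale klE0 n := klth_klScale_pos n
  have hmis := covRespCT_norm_kernel_four_mismatch_sub_le_rate hβ hB0 hB hΛ μ U K₁ K₂ hfd hs₀ hs₁ hσ X hZ hN6 hS hN4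
  have hid := kernel_four_klEffectiveAction_frame_sub_eq hβ U μ K₁ K₂ n hZ₂ X
  have hm := norm_prod_dressing_sub_one_le hβ μ K₁ K₂ hΛ hfd X
  subst hs₀ hs₁
  rw [hid]
  refine (norm_add_le _ _).trans (add_le_add ?_ hmis)
  rw [norm_mul]
  exact mul_le_mul hm hN4' (norm_nonneg _) ((norm_nonneg _).trans hm)

/-- **THE FRAME-SHIFT RESPONSE OF THE PAIR AMPLITUDE, ℓ¹-RATE FORM, BOTH p2 PRICINGS IN** (dressing `δ ≤ 600fd/Λ_n`; undressed size `N₄′` from the dressed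
amplitude `‖𝒞_n[K₂](Q;k,k′)‖ ≤ A₄`):
`‖𝒞_n[K₂](Q;k,k′) − 𝒞_n[K₁](Q;k,k′)‖ ≤ ((6075/2)·A₄/Λ_n + 24(|β|L²)³·(30·σ₁·N₆ + 8·βL²(200+200B₁)/Λ_n²·S·N₄))·frameDist K₂ K₁`.
The support-resolved instance takes `σ₁ := #{|ω|<Λ_n ∧ |e_{K₁}|<5Λ_n/4}·βL²(200+200B₁)/Λ_n²` (`sum_norm_mismatchDefect_le_support`, `card_freqBand_le`).
[cite: BenfattoGiulianiMastropietro2006, §2.3 (2.21)–(2.24)] -/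
theorem norm_klPairAmplitude_frame_sub_le_priced₁_rate {β : ℝ} (hβ : 0 < β) {B₁ : ℝ} (hB0 : 0 ≤ B₁) (hB : ∀ y, |deriv salmhoferCutoff y| ≤ B₁)
    (U μ : ℝ) (K₁ K₂ : TrigPolyC4v) (n : ℕ) (hfd : frameDist K₂ K₁ ≤ klScale klE0 n / 4)
    (hZ₂ : effPartitionFn ℂ (normalCovariance L M (uvSymbolCT L M β μ K₂ (klScale klE0 n)))
      (hubbardInteraction L M β U + counterQuadratic L M β K₂) ≠ 0)
    {s₀ s₁ : FreqMomentum L M × Fin 2 → ℂ} (hs₀ : s₀ = uvSymbolCT L M β μ K₁ (klScale klE0 n))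
    (hs₁ : s₁ = fun ks => uvSymbolCT L M β μ K₂ (klScale klE0 n) ks /
      (1 + uvSymbolCT L M β μ K₂ (klScale klE0 n) ks * (((fsub K₂ K₁).eval (latticeMomentum L ks.1.2) / (β * (L : ℝ) ^ 2) : ℝ) : ℂ)))
    {σ₁ : ℝ} (hσ : ∑ p, ‖s₁ p - s₀ p‖ ≤ σ₁ * frameDist K₂ K₁)
    (Q k k' : TorusSite 2 L) {A₄ N₆ S N₄ : ℝ}
    (hC4 : ‖klPairAmplitude L M β U μ K₂ n Q k k'‖ ≤ A₄)
    (hZ : ∀ t ∈ Set.Icc (0 : ℝ) 1, effPartitionFn ℂ (normalCovariance L M s₀ + ((t : ℂ)) • (normalCovariance L M s₁ - normalCovariance L M s₀))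
      (hubbardInteraction L M β U + counterQuadratic L M β K₁) ≠ 0)
    (hN6 : ∀ t ∈ Set.Icc (0 : ℝ) 1, ∀ A : HubbardFieldIdx L M,
      ‖kernel ℂ (effAction ℂ (normalCovariance L M s₀ + ((t : ℂ)) • (normalCovariance L M s₁ - normalCovariance L M s₀))
        (hubbardInteraction L M β U + counterQuadratic L M β K₁)) 6
        (Fin.snoc (Fin.snoc ![(((omega0 M, k'), 0), 0), ((((omega0 M).rev, Q - k'), 1), 0), ((((omega0 M).rev, Q - k), 1), 1),
          (((omega0 M, k), 0), 1)] (A.1, 1 - A.2) : Fin 5 → HubbardFieldIdx L M) A)‖ ≤ N₆)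
    (hS : ∀ t ∈ Set.Icc (0 : ℝ) 1, ∀ i : Fin 4,
      ‖kernel ℂ (effAction ℂ (normalCovariance L M s₀ + ((t : ℂ)) • (normalCovariance L M s₁ - normalCovariance L M s₀))
        (hubbardInteraction L M β U + counterQuadratic L M β K₁)) 2
        ![((((![(((omega0 M, k'), 0), 0), ((((omega0 M).rev, Q - k'), 1), 0), ((((omega0 M).rev, Q - k), 1), 1), (((omega0 M, k), 0), 1)] :
              Fin 4 → HubbardFieldIdx L M) i).1,
            1 - ((![(((omega0 M, k'), 0), 0), ((((omega0 M).rev, Q - k'), 1), 0), ((((omega0 M).rev, Q - k), 1), 1), (((omega0 M, k), 0), 1)] :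
              Fin 4 → HubbardFieldIdx L M) i).2) : HubbardFieldIdx L M),
          (![(((omega0 M, k'), 0), 0), ((((omega0 M).rev, Q - k'), 1), 0), ((((omega0 M).rev, Q - k), 1), 1), (((omega0 M, k), 0), 1)] :
              Fin 4 → HubbardFieldIdx L M) i]‖ ≤ S)
    (hN4 : ∀ t ∈ Set.Icc (0 : ℝ) 1,
      ‖kernel ℂ (effAction ℂ (normalCovariance L M s₀ + ((t : ℂ)) • (normalCovariance L M s₁ - normalCovariance L M s₀))
        (hubbardInteraction L M β U + counterQuadratic L M β K₁)) 4
        ![(((omega0 M, k'), 0), 0), ((((omega0 M).rev, Q - k'), 1), 0), ((((omega0 M).rev, Q - k), 1), 1), (((omega0 M, k), 0), 1)]‖ ≤ N₄) :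
    ‖klPairAmplitude L M β U μ K₂ n Q k k' - klPairAmplitude L M β U μ K₁ n Q k k'‖ ≤
      (6075 / 2 * A₄ / klScale klE0 n +
        24 * (|β| * (L : ℝ) ^ 2) ^ 3 * (30 * σ₁ * N₆ + 8 * (β * (L : ℝ) ^ 2 * (200 + 200 * B₁) / klScale klE0 n ^ 2) * S * N₄)) *
        frameDist K₂ K₁ := by
  have hΛ : 0 < klScale klE0 n := klth_klScale_pos n
  have hL : (0 : ℝ) < L := by exact_mod_cast NeZero.pos L
  have hfd0 : 0 ≤ frameDist K₂ K₁ := frameDist_nonneg K₂ K₁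
  have hA4 : 0 ≤ A₄ := (norm_nonneg _).trans hC4
  set X : Fin 4 → HubbardFieldIdx L M := ![(((omega0 M, k'), 0), 0), ((((omega0 M).rev, Q - k'), 1), 0), ((((omega0 M).rev, Q - k), 1), 1), (((omega0 M, k), 0), 1)] with hX
  set N₄' : ℝ := ‖kernel ℂ (effAction ℂ (normalCovariance L M s₁) (hubbardInteraction L M β U + counterQuadratic L M β K₁)) 4 X‖ with hN4'def
  -- kernel level with N₄' := the true undressed size
  have hker := norm_kernel_four_klEffectiveAction_frame_sub_le_rate (L := L) (M := M) hβ hB0 hB U μ K₁ K₂ n hfd hZ₂ hs₀ hs₁ hσ X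
    (N₄' := N₄') le_rfl hZ hN6 hS hN4
  -- the undressed size from the dressed amplitude
  have hund := norm_kernel_four_mismatchResummed_le (L := L) (M := M) hβ U μ K₁ K₂ n hZ₂ X
  have h81 := one_add_two_mul_div_pow_four_le hΛ hfd0 hfd
  have hT : 24 * (|β| * (L : ℝ) ^ 2) ^ 3 * ‖kernel ℂ (klEffectiveAction L M β U μ K₂ klE0 n) 4 X‖ = ‖klPairAmplitude L M β U μ K₂ n Q k k'‖ := by
    rw [klPairAmplitude_eq_const_mul_kernel, norm_mul, norm_pairAmplitude_const]
  have hN4'le : 24 * (|β| * (L : ℝ) ^ 2) ^ 3 * N₄' ≤ 81 / 16 * A₄ := by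
    have h1 : N₄' ≤ (1 + 2 * frameDist K₂ K₁ / klScale klE0 n) ^ 4 * ‖kernel ℂ (klEffectiveAction L M β U μ K₂ klE0 n) 4 X‖ := by
      rw [hN4'def, hs₁]; exact hund
    calc 24 * (|β| * (L : ℝ) ^ 2) ^ 3 * N₄'
        ≤ 24 * (|β| * (L : ℝ) ^ 2) ^ 3 * ((1 + 2 * frameDist K₂ K₁ / klScale klE0 n) ^ 4 * ‖kernel ℂ (klEffectiveAction L M β U μ K₂ klE0 n) 4 X‖) := by
          gcongr
      _ = (1 + 2 * frameDist K₂ K₁ / klScale klE0 n) ^ 4 * ‖klPairAmplitude L M β U μ K₂ n Q k k'‖ := by rw [← hT]; ring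
      _ ≤ 81 / 16 * A₄ := mul_le_mul h81 hC4 (norm_nonneg _) (by norm_num)
  -- to the pair amplitude
  have hpair : ‖klPairAmplitude L M β U μ K₂ n Q k k' - klPairAmplitude L M β U μ K₁ n Q k k'‖ =
      24 * (|β| * (L : ℝ) ^ 2) ^ 3 *
        ‖kernel ℂ (klEffectiveAction L M β U μ K₂ klE0 n) 4 X - kernel ℂ (klEffectiveAction L M β U μ K₁ klE0 n) 4 X‖ := by
    rw [klPairAmplitude_eq_const_mul_kernel, klPairAmplitude_eq_const_mul_kernel, ← mul_sub, norm_mul, norm_pairAmplitude_const]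
  rw [hpair]
  have hc3 : 0 ≤ 24 * (|β| * (L : ℝ) ^ 2) ^ 3 := by positivity
  calc 24 * (|β| * (L : ℝ) ^ 2) ^ 3 *
        ‖kernel ℂ (klEffectiveAction L M β U μ K₂ klE0 n) 4 X - kernel ℂ (klEffectiveAction L M β U μ K₁ klE0 n) 4 X‖
      ≤ 24 * (|β| * (L : ℝ) ^ 2) ^ 3 * (600 * frameDist K₂ K₁ / klScale klE0 n * N₄' +
          (30 * (σ₁ * frameDist K₂ K₁) * N₆ + 8 * (β * (L : ℝ) ^ 2 * (200 + 200 * B₁) / klScale klE0 n ^ 2 * frameDist K₂ K₁) * S * N₄)) :=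
        mul_le_mul_of_nonneg_left hker hc3
    _ = 600 * (24 * (|β| * (L : ℝ) ^ 2) ^ 3 * N₄') / klScale klE0 n * frameDist K₂ K₁ +
          24 * (|β| * (L : ℝ) ^ 2) ^ 3 * (30 * σ₁ * N₆ + 8 * (β * (L : ℝ) ^ 2 * (200 + 200 * B₁) / klScale klE0 n ^ 2) * S * N₄) *
            frameDist K₂ K₁ := by ring
    _ ≤ 600 * (81 / 16 * A₄) / klScale klE0 n * frameDist K₂ K₁ +
          24 * (|β| * (L : ℝ) ^ 2) ^ 3 * (30 * σ₁ * N₆ + 8 * (β * (L : ℝ) ^ 2 * (200 + 200 * B₁) / klScale klE0 n ^ 2) * S * N₄) *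
            frameDist K₂ K₁ := by gcongr
    _ = _ := by ring

end Summit.HubbardSuperconductivity.HubbardSuperconductivity.Theorems.EngineV8

end
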